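import Summits.CriticalPhenomena.PercolationContinuityZ3.Theorems.PercNearOneGluingNoHeavyLowerTailFourPointRowsLeFive

/-!
# `NoHeavyLowerTail` (crux stmt-CriticalPhenomena-4575): GENERIC packaging of the "comb certificate ⇒ kernel theorem on ≤ 5 vertices" argument for
# relabelling-equivariant families of signed cubic term lists indexed by terminal triples / quadruples

Support file (prover seat `prim-bnk-1`; `--supports stmt-CriticalPhenomena-4575`; COMPUTATIONAL only through the imported covers `cover_tri*`, `cover_quad*` of prim-cert-2, which are `native_decide` facts; no new evaluation here).

Every bounded-n kernel theorem of this programme (`…ThreePointRowsLeFive`, `…FourPointRowsLeFive`, `…E3GroupSepLeFive`, `…TerminalEdgeStepLeFive`,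
`…TerminalEdgeStepXiHqtLeFive`, `…SahiIncRowsLeFive`, `…LiftTransferLeFive`) repeats the same three steps: (1) the three-copy checker `checkC` of prim-cert-2 passes at the
standard terminal tuple of `K₃/K₄/K₅` (`native_decide`), (2) the term family commutes with vertex relabellings (`rfl`), (3) every pairwise-distinct tuple is a relabelling of the
standard one (`cover_tri*`, `cover_quad*`).  This file proves steps (2)+(3) ⇒ conclusion ONCE, for an arbitrary family `T : (n : ℕ) → Tri n → List (CTerm n)` resp.
`Quad n → …` satisfying the equivariance hypothesis `TriEquivariant T` / `QuadEquivariant T`: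

* `tri_cval_le_five`:  checks at `K₃, K₄, K₅` ⇒ `∀ n ≤ 5, ∀ w, ∀ a b c` pairwise distinct, `0 ≤ cval w (T n (a,b,c))`;
* `quad_cval_le_five`: checks at `K₄, K₅` ⇒ `∀ n ≤ 5, ∀ w, ∀ a b c d` pairwise distinct, `0 ≤ cval w (T n (a,b,c,d))`.
A new cubic row on ≤ 4 terminals then lands as: its term family (a `def`), one `rfl` equivariance lemma, two or three `native_decide` checks, and the bridge to its
probability statement (see `…HybridRowsLeFive` for the first use).
-/

namespace Summit.CriticalPhenomena.PercolationContinuityZ3.Theorems.CombRows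

open Finset MeasureTheory OneCutCert CovTransferCert E3GroupSepCert
open scoped BigOperators
open Literature.Probability.Percolation Literature.Probability.LatticeModels

variable {n : ℕ}

/-- A cubic term read through the vertex relabelling `τ`. [this work] -/
def relT (τ : Fin n ≃ Fin n) (z : CTerm n) : CTerm n := (z.1, relP τ z.2.1, relP τ z.2.2.1, relP τ z.2.2.2)

/-- `cval` at relabelled weights = `cval` of the `σ.symm`-relabelled terms (restatement of `cval_map_relP` with `relT`). [this work] -/
theorem cval_relabelW (σ : Fin n ≃ Fin n) (w : Sym2 (Fin n) → unitInterval) (ts : List (CTerm n)) :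
    cval (relabelW σ w) ts = cval w (ts.map (relT σ.symm)) :=
  cval_map_relP σ w ts

/-! ## Triple-indexed families -/

/-- A triple-indexed term family commutes with relabellings. [this work] -/
def TriEquivariant (T : (n : ℕ) → Tri n → List (CTerm n)) : Prop :=
  ∀ (n : ℕ) (τ : Fin n ≃ Fin n) (t : Tri n), (T n t).map (relT τ) = T n (trimap τ t)

/-- Transport of a triple family along a relabelling. [this work] -/
theorem tri_relabel {T : (n : ℕ) → Tri n → List (CTerm n)} (hT : TriEquivariant T) (σ : Fin n ≃ Fin n)
    (w : Sym2 (Fin n) → unitInterval) (t : Tri n) (h : 0 ≤ cval w (T n t)) : 0 ≤ cval (relabelW σ w) (T n (trimap σ t)) := by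
  rw [cval_relabelW, hT n σ.symm, trimap_symm_trimap]
  exact h

/-- Transport of validity at all weights (triples). [this work] -/
theorem tri_forall_relabel {T : (n : ℕ) → Tri n → List (CTerm n)} (hT : TriEquivariant T) (σ : Fin n ≃ Fin n) {t : Tri n}
    (h : ∀ w : Sym2 (Fin n) → unitInterval, 0 ≤ cval w (T n t)) (w : Sym2 (Fin n) → unitInterval) : 0 ≤ cval w (T n (trimap σ t)) := by
  have hw : relabelW σ (fun e => w (sym2Equiv σ e)) = w := by
    funext e
    unfold relabelW
    simp only [Equiv.apply_symm_apply]
  rw [← hw]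
  exact tri_relabel hT σ _ t (h _)

/-- **Triple families: comb checks at `K₃, K₄, K₅` give the row on every weighted graph with at most five vertices.** [this work] -/
theorem tri_cval_le_five {T : (n : ℕ) → Tri n → List (CTerm n)} (hT : TriEquivariant T) {σ₃ σ₄ σ₅ : ℕ}
    (h3 : checkC 3 σ₃ (T 3 (tri₀ 3 le_rfl)) = true) (h4 : checkC 4 σ₄ (T 4 (tri₀ 4 (by norm_num))) = true)
    (h5 : checkC 5 σ₅ (T 5 (tri₀ 5 (by norm_num))) = true) :
    ∀ n ≤ 5, ∀ (w : Sym2 (Fin n) → unitInterval) (a b c : Fin n), a ≠ b → a ≠ c → b ≠ c → 0 ≤ cval w (T n (a, b, c)) := by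
  intro n hn w a b c hab hac hbc
  interval_cases n
  · exact a.elim0
  · exact absurd (Subsingleton.elim a b) hab
  · have : c = a ∨ c = b := by omega
    rcases this with h | h
    · exact absurd h.symm hac
    · exact absurd h.symm hbc
  · obtain ⟨σ, hσ⟩ := cover_tri3 _ (mem_distinctTri hab hac hbc)
    rw [← hσ]
    exact tri_forall_relabel hT σ (fun w' => checkC_sound σ₃ _ h3 w') w
  · obtain ⟨σ, hσ⟩ := cover_tri4 _ (mem_distinctTri hab hac hbc)
    rw [← hσ]
    exact tri_forall_relabel hT σ (fun w' => checkC_sound σ₄ _ h4 w') w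
  · obtain ⟨σ, hσ⟩ := cover_tri5 _ (mem_distinctTri hab hac hbc)
    rw [← hσ]
    exact tri_forall_relabel hT σ (fun w' => checkC_sound σ₅ _ h5 w') w

/-! ## Quadruple-indexed families -/

/-- A quadruple-indexed term family commutes with relabellings. [this work] -/
def QuadEquivariant (T : (n : ℕ) → Quad n → List (CTerm n)) : Prop :=
  ∀ (n : ℕ) (τ : Fin n ≃ Fin n) (x : Quad n), (T n x).map (relT τ) = T n (quadmap τ x)

/-- Transport of a quadruple family along a relabelling. [this work] -/
theorem quad_relabel {T : (n : ℕ) → Quad n → List (CTerm n)} (hT : QuadEquivariant T) (σ : Fin n ≃ Fin n)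
    (w : Sym2 (Fin n) → unitInterval) (x : Quad n) (h : 0 ≤ cval w (T n x)) : 0 ≤ cval (relabelW σ w) (T n (quadmap σ x)) := by
  rw [cval_relabelW, hT n σ.symm, quadmap_symm_quadmap]
  exact h

/-- Transport of validity at all weights (quadruples). [this work] -/
theorem quad_forall_relabel {T : (n : ℕ) → Quad n → List (CTerm n)} (hT : QuadEquivariant T) (σ : Fin n ≃ Fin n) {x : Quad n}
    (h : ∀ w : Sym2 (Fin n) → unitInterval, 0 ≤ cval w (T n x)) (w : Sym2 (Fin n) → unitInterval) : 0 ≤ cval w (T n (quadmap σ x)) := by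
  have hw : relabelW σ (fun e => w (sym2Equiv σ e)) = w := by
    funext e
    unfold relabelW
    simp only [Equiv.apply_symm_apply]
  rw [← hw]
  exact quad_relabel hT σ _ x (h _)

/-- **Quadruple families: comb checks at `K₄, K₅` give the row on every weighted graph with at most five vertices.** [this work] -/
theorem quad_cval_le_five {T : (n : ℕ) → Quad n → List (CTerm n)} (hT : QuadEquivariant T) {σ₄ σ₅ : ℕ}
    (h4 : checkC 4 σ₄ (T 4 (quad₀ 4 le_rfl)) = true) (h5 : checkC 5 σ₅ (T 5 (quad₀ 5 (by norm_num))) = true) :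
    ∀ n ≤ 5, ∀ (w : Sym2 (Fin n) → unitInterval) (a b c d : Fin n), a ≠ b → a ≠ c → a ≠ d → b ≠ c → b ≠ d → c ≠ d →
      0 ≤ cval w (T n (a, b, c, d)) := by
  intro n hn w a b c d hab hac had hbc hbd hcd
  interval_cases n
  · exact a.elim0
  · exact absurd (Subsingleton.elim a b) hab
  · have : c = a ∨ c = b := by omega
    rcases this with h | h
    · exact absurd h.symm hac
    · exact absurd h.symm hbc
  · have : d = a ∨ d = b ∨ d = c := by omega
    rcases this with h | h | h
    · exact absurd h.symm had
    · exact absurd h.symm hbd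
    · exact absurd h.symm hcd
  · obtain ⟨σ, hσ⟩ := cover_quad4 _ (mem_distinctQuad hab hac had hbc hbd hcd)
    rw [← hσ]
    exact quad_forall_relabel hT σ (fun w' => checkC_sound σ₄ _ h4 w') w
  · obtain ⟨σ, hσ⟩ := cover_quad5 _ (mem_distinctQuad hab hac had hbc hbd hcd)
    rw [← hσ]
    exact quad_forall_relabel hT σ (fun w' => checkC_sound σ₅ _ h5 w') w

end Summit.CriticalPhenomena.PercolationContinuityZ3.Theorems.CombRows
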